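import Mathlib
import Literature.MathematicalPhysics.MHD.HainLustSigmaStability
import Summits.Ventures.FusionMHD.Models.TearingFRS1EqIdealSigmaBoundR5
import Summits.Ventures.FusionMHD.Models.TearingFRS1EqSigmaAllCert
import HarnessLib

/-!
# F3.σ «#66 FOR EVERY σ»: the ideal `(2,1)` mode of the FORCE-BALANCED FRS1 screw pinch (lit-4's row #66 MODEL M) is σ-stable for
# EVERY `σ ≠ 0`, hence satisfies the ENERGY PRINCIPLE `W ≥ 0` — σ-uniform rational Riccati certificate on `0 < σ² ≤ 10⁻⁴`, row #66 at
# `σ = 1/100`, monotonicity of `W + σ²I`, and the limit `σ → 0`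

LADDER-GRIDFUSION rung F3, the marginal end of the σ-ladder of row #66 «F3.σ-FRS1EQ-IDEAL21» (riders «#66″ σ3», «#66‴ σ4»); seat
`gridfusion-sos-6` g5, 2026-08-27; generator `HOME/cert/sos-6/sigma/{sigma_bivar_p.py, sigma_all_eq.py, emit_all_eq.py}`.  MODEL M = lit-4's
EXACT force-balanced FRS-1-like screw pinch `EqSigmaR5.hl5` (`q = (7/5)(1 + r²)`, `B_z ≡ 1`, `B_θ = r·u5`, `u5 = 1/(7(1+r²))`, pressure from
force balance `p5 = 1/(98(1+r²)²) − 1/392 + 1/19600` (`β₀ ≈ 1.54 %` MODELLED), `ρ ≡ 1`, `γ = 5/3`, `μ₀ = 1`, `R₀ = 5a` MODELLED, wall AT the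
plasma; `isRadialPressureBalance5` proved there) — `hl5`, `u5`, `p5`, `contDiff_u5/p5`, `p5_pos`, `sigma_bound5_of_le`, `kineticNorm_nonneg5`
IMPORTED BY NAME from `Models/TearingFRS1EqIdealSigmaBoundR5.lean`; the σ-symbolic certificate (`thetaσEq`, `hpolyσEq`, `abs_thetaσEq_le`,
`PiE`, …) from `Models/TearingFRS1EqSigmaAllCert.lean` and its Data files.

THE MATHEMATICS.  `ScrewPinch.DynProfile.sigmaModifiedEnergy_pos_of_polyRiccati` (tree v7; Hartman's Riccati certificate form of the
Goedbloed–Sakanaka σ-stability theorem) for EVERY `σ` with `0 < σ² ≤ 10⁻⁴`, with the σ-uniform RATIONAL certificate `θ̃_σ = P_σ/Q_σ`,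
`ε = 3σ²`, `Θ(σ) = Π(σ)/(q₁σ²)` and the kernel-checked `N(r, σ²) > 0` on `[0, 1] × (0, 10⁻⁴]` (Bernstein in `σ²`; the marginal slice
`N(·, 0) = (7r² − 3)¹⁰·c₀` has a TENTH-order zero on the resonant surface `r² = 3/7`, the `σ^{2j}`-slices vanish there to the exact orders
`10 − 2j`, `j ≤ 4` — the quasi-homogeneous structure that the g4 census misread as a sign change); for `|σ| ≥ 1/100` lit-4's
`sigma_bound5_of_le` (row #66 + `I ≥ 0`).  The limit `σ → 0` gives `W ≥ 0`.

CERTIFIED (kernel): `sigma_bound_Eq_all` — CLASS C = mode `(m, k) = (2, −1/5)`, admissible `(ξ, η, ζ)` (`ξ ∈ C¹(−b, b)`, `1 < b ≤ 1001/1000`,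
`ξ(1) = 0`, `ξ ≢ 0` on `(0,1]`, finite energy and norm): `W + σ²I > 0` FOR EVERY `σ ≠ 0` — in the spectral reading (GoedbloedPoedts2004
(6.117); §9.4.1 Theorem p. 470) NO IDEAL `(2,1)` MODE OF THE FORCE-BALANCED MODEL M GROWS EXPONENTIALLY AT ANY RATE (`growthRate_eq_zero_Eq`);
`potentialEnergy_nonneg_Eq` — THE ENERGY PRINCIPLE `W ≥ 0` for every class-C displacement of this mode.  HONESTY (three columns): ONE Fourier
mode of ONE cylindrical model, wall at the plasma, marginal `W = 0` not excluded; the SAME model VIOLATES Suydam's criterion near the axis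
(#82 «F3.σ-SUYDAM-FRS1EQ-CORE», model-7: Suydam fails on `0 < r < 0.2755`, and a compactly supported internal `(3,2)` displacement has NEGATIVE ideal energy — so MODEL M as a whole is NOT ideal-stable; the present row is about the `(2,1)` mode only), and the resistive `(2,1)` tearing index of the same `q` is
positive (rows #13/#38) — juxtaposed, never merged, never «MHD stable»; not about any device.  No `native_decide`, no `sorry`; axioms
standard.  [instance data]
-/

noncomputable section

open Set Polynomial Literature.MathematicalPhysics.MHD
open Literature.Analysis.ValidatedNumerics Literature.Analysis.ValidatedNumerics.ExpPoly

namespace Summit.Ventures.FusionMHD.Models.TearingFRS1.EqSigmaR5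

/-- σ-STABILITY FOR SMALL σ (`0 < σ² ≤ 10⁻⁴`) on the force-balanced MODEL M: `W + σ²I > 0` for every class-C displacement of the `(2,1)`
mode, by `sigmaModifiedEnergy_pos_of_polyRiccati` with the σ-uniform rational certificate `θ̃_σ`, `ε = 3σ²`, `Θ(σ) = Π(σ)/(q₁σ²)`.
[instance data] -/
theorem sigma_bound_Eq_of_sq_le {b : ℝ} (hb : 1 < b) (hb' : b ≤ 1001 / 1000) {σ : ℝ} (hσ : σ ≠ 0) (hs : σ ^ 2 ≤ 1 / 10000)
    {ξ η ζ : ℝ → ℝ} (hξ : ContDiffOn ℝ 1 ξ (Ioo (-b) b)) (hξa : ξ 1 = 0) (hξne : ∃ r ∈ Ioc (0 : ℝ) 1, ξ r ≠ 0)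
    (hW : IntervalIntegrable (hl5.potentialDensity 2 (-1 / 5) ξ η ζ) MeasureTheory.volume 0 1)
    (hI : IntervalIntegrable (hl5.kineticDensity ξ η ζ) MeasureTheory.volume 0 1) :
    0 < hl5.sigmaModifiedEnergy 2 (-1 / 5) σ 1 ξ η ζ := by
  refine ScrewPinch.DynProfile.sigmaModifiedEnergy_pos_of_polyRiccati (P := hl5) (a := 1) (b := b)
    (u := u5) (θ := thetaσEq σ) (θ' := thetaσEq' σ) (Θ := PiE σ / ((1750917/200 : ℝ) * σ ^ 2)) (ε := 3 * σ ^ 2)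
    one_pos hb (Or.inl two_ne_zero) hσ (by show (0 : ℝ) < 1; norm_num)
    (by show (0 : ℝ) ≤ 5 / 3; norm_num) contDiffOn_const contDiff_p5.contDiffOn contDiffOn_const
    contDiff_u5.contDiffOn (fun r _ => rfl) (fun r _ => by show (0 : ℝ) < 1; norm_num)
    (fun r hr => (p5_pos hr.1 (by linarith [hr.2])).le) (fun r _ => ?_)
    (fun r hr => hasDerivAt_thetaσEq hσ ⟨hr.1, lt_of_lt_of_le hr.2 hb'⟩)
    ((continuousOn_thetaσEq' hσ).mono (Ioo_subset_Ioo_right hb')) (fun r hr => abs_thetaσEq_le hσ hr) (by positivity)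
    (fun r hr => hpolyσEq hσ hs hr) hξ hξa hξne hW hI
  show 0 < (r * u5 r) ^ 2 + (1 : ℝ) ^ 2
  positivity

/-- **«#66 FOR EVERY σ»** (CERTIFIED, MODEL M = lit-4's force-balanced `hl5`, CLASS C): for `1 < b ≤ 1001/1000`, EVERY admissible
three-component displacement `(ξ, η, ζ)` of the Fourier mode `(m, k) = (2, −1/5)` (`ξ ∈ C¹(−b, b)`, `ξ(1) = 0`, `ξ ≢ 0` on `(0, 1]`, finite
energy and norm) has `W + σ²I > 0` FOR EVERY `σ ≠ 0`: no ideal `(2,1)` mode of the force-balanced MODEL M grows exponentially at any rate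
(GoedbloedPoedts2004 §9.4.1 Theorem: «σ-stable» for every σ).  Proof: `σ² ≤ 10⁻⁴` by the σ-uniform rational certificate
(`sigma_bound_Eq_of_sq_le`); `|σ| ≥ 1/100` is lit-4's `sigma_bound5_of_le` (row #66 + monotonicity of `W + σ²I` in `σ²`).  The SAME model
violates Suydam's criterion near the axis (#82) and has a positive resistive `(2,1)` tearing index on the same `q` (rows #13/#38):
juxtaposed, never merged; never «MHD stable»; not about any device. [instance data] -/
theorem sigma_bound_Eq_all {b : ℝ} (hb : 1 < b) (hb' : b ≤ 1001 / 1000) {σ : ℝ} (hσ : σ ≠ 0)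
    {ξ η ζ : ℝ → ℝ} (hξ : ContDiffOn ℝ 1 ξ (Ioo (-b) b)) (hξa : ξ 1 = 0) (hξne : ∃ r ∈ Ioc (0 : ℝ) 1, ξ r ≠ 0)
    (hW : IntervalIntegrable (hl5.potentialDensity 2 (-1 / 5) ξ η ζ) MeasureTheory.volume 0 1)
    (hI : IntervalIntegrable (hl5.kineticDensity ξ η ζ) MeasureTheory.volume 0 1) :
    0 < hl5.sigmaModifiedEnergy 2 (-1 / 5) σ 1 ξ η ζ := by
  by_cases hs : σ ^ 2 ≤ 1 / 10000
  · exact sigma_bound_Eq_of_sq_le hb hb' hσ hs hξ hξa hξne hW hI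
  · have hσ' : 1 / 100 ≤ |σ| := by
      by_contra hlt
      rw [not_le] at hlt
      have h2 := mul_self_lt_mul_self (abs_nonneg σ) hlt
      rw [abs_mul_abs_self] at h2
      exact hs (by nlinarith [h2])
    exact sigma_bound5_of_le hb hb' hσ' hξ hξa hξne hW hI

/-- **THE ENERGY PRINCIPLE FOR THE `(2,1)` MODE** (limit form, CERTIFIED): every class-C displacement of the mode `(2, −1/5)` of the
force-balanced MODEL M has `W ≥ 0` (`W + σ²I > 0` for every `σ ≠ 0`, `I ≥ 0`; `σ → 0`).  The classical ideal-MHD energy-principle statement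
for ONE Fourier mode of ONE cylindrical model with the wall at the plasma — marginal `W = 0` not excluded, Suydam violated elsewhere in the
same model (#82); never «MHD stable»; not about any device. [instance data] -/
theorem potentialEnergy_nonneg_Eq {b : ℝ} (hb : 1 < b) (hb' : b ≤ 1001 / 1000)
    {ξ η ζ : ℝ → ℝ} (hξ : ContDiffOn ℝ 1 ξ (Ioo (-b) b)) (hξa : ξ 1 = 0) (hξne : ∃ r ∈ Ioc (0 : ℝ) 1, ξ r ≠ 0)
    (hW : IntervalIntegrable (hl5.potentialDensity 2 (-1 / 5) ξ η ζ) MeasureTheory.volume 0 1)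
    (hI : IntervalIntegrable (hl5.kineticDensity ξ η ζ) MeasureTheory.volume 0 1) :
    0 ≤ hl5.potentialEnergy 2 (-1 / 5) 1 ξ η ζ := by
  by_contra hneg
  rw [not_le] at hneg
  have hI0 : 0 ≤ hl5.kineticNorm 1 ξ η ζ := kineticNorm_nonneg5 ξ η ζ
  have hden : 0 < 2 * (hl5.kineticNorm 1 ξ η ζ + 1) := by linarith
  have hs0 : 0 < -hl5.potentialEnergy 2 (-1 / 5) 1 ξ η ζ / (2 * (hl5.kineticNorm 1 ξ η ζ + 1)) := div_pos (by linarith) hden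
  have hσ : Real.sqrt (-hl5.potentialEnergy 2 (-1 / 5) 1 ξ η ζ / (2 * (hl5.kineticNorm 1 ξ η ζ + 1))) ≠ 0 :=
    (Real.sqrt_pos.mpr hs0).ne'
  have h := sigma_bound_Eq_all hb hb' hσ hξ hξa hξne hW hI
  unfold ScrewPinch.DynProfile.sigmaModifiedEnergy at h
  rw [Real.sq_sqrt hs0.le] at h
  have e : -hl5.potentialEnergy 2 (-1 / 5) 1 ξ η ζ / (2 * (hl5.kineticNorm 1 ξ η ζ + 1)) * (2 * (hl5.kineticNorm 1 ξ η ζ + 1))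
      = -hl5.potentialEnergy 2 (-1 / 5) 1 ξ η ζ := by
    field_simp
  nlinarith

/-- SPECTRAL READING: a class-C displacement of the `(2,1)` mode obeying the normal-mode energy identity `W = −γ²I` with `I > 0` has
`γ = 0` — no exponential growth at ANY rate (the identity is a HYPOTHESIS; nothing is claimed about the existence of modes). [instance data] -/
theorem growthRate_eq_zero_Eq {b : ℝ} (hb : 1 < b) (hb' : b ≤ 1001 / 1000)
    {ξ η ζ : ℝ → ℝ} (hξ : ContDiffOn ℝ 1 ξ (Ioo (-b) b)) (hξa : ξ 1 = 0) (hξne : ∃ r ∈ Ioc (0 : ℝ) 1, ξ r ≠ 0)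
    (hW : IntervalIntegrable (hl5.potentialDensity 2 (-1 / 5) ξ η ζ) MeasureTheory.volume 0 1)
    (hI : IntervalIntegrable (hl5.kineticDensity ξ η ζ) MeasureTheory.volume 0 1)
    {γ : ℝ} (hmode : hl5.potentialEnergy 2 (-1 / 5) 1 ξ η ζ = -γ ^ 2 * hl5.kineticNorm 1 ξ η ζ)
    (hIpos : 0 < hl5.kineticNorm 1 ξ η ζ) : γ = 0 := by
  have hW0 := potentialEnergy_nonneg_Eq hb hb' hξ hξa hξne hW hI
  rw [hmode] at hW0
  have hγ2 : γ ^ 2 ≤ 0 := by nlinarith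
  exact pow_eq_zero_iff (n := 2) (by norm_num) |>.mp (le_antisymm hγ2 (sq_nonneg γ))

end Summit.Ventures.FusionMHD.Models.TearingFRS1.EqSigmaR5

end
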